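import Literature.Topology.FourManifolds.TrisectionFunctor
import Literature.Topology.FourManifolds.Trisections
import Literature.Topology.FourManifolds.GroupTrisections
import Literature.Topology.FourManifolds.TrisectionCentralSurfaceMarking
import Literature.Topology.FourManifolds.LickorishWallaceLeaves
import Literature.Topology.FourManifolds.LickorishWallaceHandlebodies
import Literature.Topology.FourManifolds.OneHandleStepExists
import Literature.Topology.FourManifolds.SPC4HandlesProofs
import Literature.Topology.FourManifolds.GenusOneHandlebodyBoundary
import Literature.Topology.FourManifolds.NormalRetraction
import Literature.Topology.FourManifolds.SmoothEmbeddingCriteria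
import Literature.Topology.FourManifolds.BallGluingCharts
import Mathlib.Geometry.Manifold.WhitneyEmbedding
import Mathlib.Geometry.Manifold.PartitionOfUnity
import HarnessLib
import Literature.Topology.FourManifolds.DehnNielsenBaerSurface

/-!
# Stub `stub_dehnNielsenBaer` of line `lp-by-sphere-system-surgery` for crux `AgkCor6Sufficiency`
(item stmt-SmoothPoincare4-10894, routes `CongruenceShadows` / `GroupTrisection`; lead reshape r2)

`DehnNielsenBaerCentral` (declared verbatim from the skeleton with the predicate `AmbientSmooth`):
for balanced `(g, k)` Gay–Kirby trisections of closed connected oriented `X`, `X'`, every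
`θ : π₁(F, x₀) ≅ π₁(F', x₀')` between the central surfaces is induced by a based homeomorphism
`ψ : F ≅ F'` which, with its inverse, is AMBIENTLY SMOOTH (near `F` the restriction of a `C^∞` map
of an open set of the ambient `4`-manifold).  Proved FROM `DehnNielsenBaerSurfaceSmooth` (the
delegated fact `stub_dnbSurface`, declared verbatim, cited for relocation, the HYPOTHESIS of the
stub).  Proof (`dehnNielsenBaerCentral_of_surfaceSmooth`): clause (iii) gives smooth embeddings
`f : H → X`, `f' : H' → X'` of genus-`g` handlebodies with `f(∂H) = F`, `f'(∂H') = F'`;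
`Θ : H ≅ H'` (UNIQ, proved in the tree); the fact realises the discrepancy of the transported
markings by a based diffeomorphism `φ` of `∂H'`; `ψ = f' ∘ φ ∘ Θ ∘ f⁻¹` on `F`, `ψ_* = θ`.
Ambient smoothness: locally along `F` such maps are restrictions of smooth maps of OPEN sets
(`exists_local_ambient_extension'`: slice charts of the immersion `f` at boundary points +
invariance of the boundary), and local extensions glue (`exists_ambient_extension_of_local'`:
Whitney embedding of the target, smooth normal retraction `exists_normalRetraction`, partition of
unity) — private copies of the lemmas of `Literature/Topology/FourManifolds/AmbientSmoothExtension.lean`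
(p93382, landed for this stub; not imported while its build is pending).  No `sorry`.
-/

noncomputable section

set_option linter.dupNamespace false

namespace Summit.SmoothPoincare4.SmoothPoincare4.Cruxes.AgkCor6Sufficiency.LpBySphereSystemSurgery

open Set Function
-- `_root_`-qualified: the gate relocates the cited fact into `namespace Literature.Topology.FourManifolds`
open scoped _root_.Manifold _root_.ContDiff _root_.Topology _root_.ContinuousMap
open Literature.Topology.FourManifolds

section Central

variable {X : Type} [TopologicalSpace X] [ChartedSpace (EuclideanSpace ℝ (Fin 4)) X]
  {X' : Type} [TopologicalSpace X'] [ChartedSpace (EuclideanSpace ℝ (Fin 4)) X']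

/-- A map `ψ : F → F'` between the central surfaces of two trisections is **ambiently smooth**:
near `F` it is the restriction of a `C^∞` map `X → X'` (Milnor's definition of smooth maps on
subsets; for the closed submanifold `F` this is smoothness of `ψ : F → X'`). -/
def AmbientSmooth (S : Fin 3 → Set X) (S' : Fin 3 → Set X')
    (ψ : centralSurface S → centralSurface S') : Prop :=
  ∃ (U : Set X) (Ψ : X → X'), IsOpen U ∧ (⋂ l, S l) ⊆ U ∧ ContMDiffOn (𝓡 4) (𝓡 4) ∞ Ψ U ∧
    ∀ x : centralSurface S, Ψ x = (ψ x : X')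

end Central

/-- **Dehn–Nielsen–Baer on central surfaces** (based, smooth, possibly orientation-reversing,
two-surface form; Nielsen 1927, Baer 1928, Epstein 1966; Zieschang–Vogt–Coldewey Thm 5.6.2;
Farb–Margalit Thm 8.1 / 8.8): for balanced Gay–Kirby trisections of two closed connected oriented
smooth `4`-manifolds with the same `(g, k)`, every isomorphism `θ : π₁(F, x₀) ≅ π₁(F', x₀')`
between the fundamental groups of the central surfaces (closed orientable genus-`g` surfaces,
`F = h(∂H)` by clause (iii)) is induced by a based homeomorphism `ψ : F ≅ F'`, smooth with smooth
inverse in the ambient sense. -/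
def DehnNielsenBaerCentral : Prop :=
  ∀ (X : Type) [TopologicalSpace X] [T2Space X] [SecondCountableTopology X]
    [ChartedSpace (EuclideanSpace ℝ (Fin 4)) X] [IsManifold (𝓡 4) ∞ X] [CompactSpace X]
    [ConnectedSpace X] (_ : SmoothOrientation (𝓡 4) X)
    (X' : Type) [TopologicalSpace X'] [T2Space X'] [SecondCountableTopology X']
    [ChartedSpace (EuclideanSpace ℝ (Fin 4)) X'] [IsManifold (𝓡 4) ∞ X'] [CompactSpace X']
    [ConnectedSpace X'] (_ : SmoothOrientation (𝓡 4) X')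
    (g k : ℕ) (S : Fin 3 → Set X) (S' : Fin 3 → Set X')
    (_ : IsBalancedGKTrisection X g k S) (_ : IsBalancedGKTrisection X' g k S')
    (x₀ : centralSurface S) (x₀' : centralSurface S')
    (_ : SurfaceGroup g ≃* FundamentalGroup (centralSurface S) x₀)
    (θ : FundamentalGroup (centralSurface S) x₀ ≃* FundamentalGroup (centralSurface S') x₀'),
    ∃ (ψ : centralSurface S ≃ₜ centralSurface S') (hψ : ψ x₀ = x₀'),
      AmbientSmooth S S' ψ ∧ AmbientSmooth S' S ψ.symm ∧
      ∀ γ, FundamentalGroup.mapOfEq (⟨ψ, ψ.continuous⟩ : C(centralSurface S, centralSurface S')) hψ γ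
        = θ γ

section LocalExtension

variable {M : Type*} [TopologicalSpace M] [ChartedSpace (EuclideanHalfSpace 3) M]
  [IsManifold (𝓡∂ 3) ∞ M] {X : Type*} [TopologicalSpace X] [ChartedSpace (EuclideanSpace ℝ (Fin 4)) X]
  {Y : Type*} [TopologicalSpace Y] [ChartedSpace (EuclideanSpace ℝ (Fin 4)) Y]
  {T : Type*} [TopologicalSpace T] [ChartedSpace (EuclideanSpace ℝ (Fin 2)) T]

/-- **Local ambient extension along a smoothly embedded `3`-manifold with boundary**: in the slice
charts `(φ, χ, L)` of the immersion `h₁` at the boundary point `σ z`, `Ψ = F ∘ τ ∘ φ⁻¹ ∘ fl ∘ pr₁ ∘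
L⁻¹ ∘ χ` with `fl` the projection onto the boundary hyperplane (invariance of the boundary).
(Copy of `Literature.Topology.FourManifolds.exists_local_ambient_extension`, p93382.) [folklore] -/
private theorem exists_local_ambient_extension' {h₁ : M → X}
    (hh₁ : Manifold.IsSmoothEmbedding (𝓡∂ 3) (𝓡 4) ∞ h₁)
    {σ : T → M} {τ : M → T} (hτσ : ∀ z, τ (σ z) = z) (hσ : ∀ z, σ z ∈ (𝓡∂ 3).boundary M)
    (hτ : ContMDiffOn (𝓡∂ 3) (𝓡 2) ∞ τ ((𝓡∂ 3).boundary M))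
    {F : T → Y} (hF : ContMDiff (𝓡 2) (𝓡 4) ∞ F) (z : T) :
    ∃ V : Set X, IsOpen V ∧ h₁ (σ z) ∈ V ∧ ∃ Ψ : X → Y, ContMDiffOn (𝓡 4) (𝓡 4) ∞ Ψ V ∧
      ∀ z', h₁ (σ z') ∈ V → Ψ (h₁ (σ z')) = F z' := by
  obtain ⟨C, _, _, hC⟩ := hh₁.isImmersion
  have hm := hC (σ z)
  have hrange : ∀ {u : EuclideanSpace ℝ (Fin 3)}, u 0 = 0 → u ∈ range (𝓡∂ 3) := fun h => by
    rw [range_modelWithCornersEuclideanHalfSpace]; exact le_of_eq h.symm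
  have hfront : ∀ {u : EuclideanSpace ℝ (Fin 3)}, u ∈ frontier (range (𝓡∂ 3)) ↔ u 0 = 0 := by
    intro u; rw [frontier_range_modelWithCornersEuclideanHalfSpace]
    exact ⟨fun h => (h : 0 = u 0).symm, fun h => (h.symm : 0 = u 0)⟩
  -- the linear projection onto the boundary hyperplane `{u | u 0 = 0}`
  let fl : EuclideanSpace ℝ (Fin 3) →L[ℝ] EuclideanSpace ℝ (Fin 3) := ContinuousLinearMap.id ℝ _ -
    (EuclideanSpace.proj (0 : Fin 3)).smulRight (EuclideanSpace.single (0 : Fin 3) (1 : ℝ))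
  have fl_apply : ∀ u, fl u = u - u 0 • EuclideanSpace.single (0 : Fin 3) (1 : ℝ) := fun u => rfl
  have fl_zero : ∀ u, fl u 0 = 0 := fun u => by simp [fl_apply]
  have fl_id : ∀ {u : EuclideanSpace ℝ (Fin 3)}, u 0 = 0 → fl u = u := fun h => by simp [fl_apply, h]
  obtain ⟨U₁, hU₁, hU₁eq⟩ := hh₁.isEmbedding.isInducing.isOpen_iff.1 hm.domChart.open_source
  set q : X → EuclideanSpace ℝ (Fin 3) := fun x => fl (hm.equiv.symm (hm.codChart.extend (𝓡 4) x)).1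
  have hqs : ContMDiffOn (𝓡 4) 𝓘(ℝ, EuclideanSpace ℝ (Fin 3)) ∞ q hm.codChart.source := by
    have h2 : ContMDiff 𝓘(ℝ, EuclideanSpace ℝ (Fin 4)) 𝓘(ℝ, EuclideanSpace ℝ (Fin 3)) ∞
        (fun v => fl (hm.equiv.symm v).1) := by
      rw [contMDiff_iff_contDiff]; exact fl.contDiff.comp (contDiff_fst.comp hm.equiv.symm.contDiff)
    exact h2.comp_contMDiffOn (hm.codChart.contMDiffOn_extend hm.codChart_mem_maximalAtlas)
  have hq0 : ∀ x, q x 0 = 0 := fun x => fl_zero _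
  -- on `h₁ (φ.source ∩ ∂M)` the map `q` is the chart `φ`
  have key : ∀ w ∈ hm.domChart.source, w ∈ (𝓡∂ 3).boundary M → q (h₁ w) = hm.domChart.extend (𝓡∂ 3) w ∧
      hm.domChart.extend (𝓡∂ 3) w ∈ (hm.domChart.extend (𝓡∂ 3)).target := by
    intro w hw hwb
    have hws : w ∈ (hm.domChart.extend (𝓡∂ 3)).source := by rwa [OpenPartialHomeomorph.extend_source]
    refine ⟨?_, (hm.domChart.extend (𝓡∂ 3)).map_source hws⟩
    have hwr := hm.writtenInCharts ((hm.domChart.extend (𝓡∂ 3)).map_source hws)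
    simp only [comp_apply, (hm.domChart.extend (𝓡∂ 3)).left_inv hws] at hwr
    have h0 : hm.domChart.extend (𝓡∂ 3) w 0 = 0 := hfront.1 ((isBoundaryPoint_iff_of_mem_maximalAtlas
      (I := 𝓡∂ 3) (m := ∞) (by simp) hm.domChart_mem_maximalAtlas hw).1 hwb)
    show fl (hm.equiv.symm (hm.codChart.extend (𝓡 4) (h₁ w))).1 = _
    rw [hwr, ContinuousLinearEquiv.symm_apply_apply]
    exact fl_id h0
  set V := U₁ ∩ (hm.codChart.source ∩ q ⁻¹' ((𝓡∂ 3).symm ⁻¹' hm.domChart.target)) with hV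
  have htarget : ∀ x ∈ V, q x ∈ (hm.domChart.extend (𝓡∂ 3)).target := by
    rintro x ⟨-, -, hx⟩; rw [OpenPartialHomeomorph.extend_target]; exact ⟨hx, hrange (hq0 x)⟩
  refine ⟨V, ?_, ?_, fun x => F (τ ((hm.domChart.extend (𝓡∂ 3)).symm (q x))), ?_, ?_⟩
  · exact hU₁.inter (hqs.continuousOn.isOpen_inter_preimage hm.codChart.open_source
      (hm.domChart.open_target.preimage (𝓡∂ 3).continuous_symm))
  · obtain ⟨hq', hu⟩ := key (σ z) hm.mem_domChart_source (hσ z)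
    refine ⟨show σ z ∈ h₁ ⁻¹' U₁ from hU₁eq ▸ hm.mem_domChart_source, hm.mem_codChart_source, ?_⟩
    show q (h₁ (σ z)) ∈ (𝓡∂ 3).symm ⁻¹' hm.domChart.target
    rw [OpenPartialHomeomorph.extend_target] at hu
    exact hq' ▸ hu.1
  · have hmaps₁ : MapsTo q V ((𝓡∂ 3) '' hm.domChart.target) := fun x hx =>
      ⟨(𝓡∂ 3).symm (q x), hx.2.2, (𝓡∂ 3).right_inv (hrange (hq0 x))⟩
    have hmaps₂ : ∀ x ∈ V, (hm.domChart.extend (𝓡∂ 3)).symm (q x) ∈ (𝓡∂ 3).boundary M := by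
      intro x hx
      have ht := htarget x hx
      have hsrc : (hm.domChart.extend (𝓡∂ 3)).symm (q x) ∈ hm.domChart.source := by
        rw [← OpenPartialHomeomorph.extend_source (I := 𝓡∂ 3)]
        exact (hm.domChart.extend (𝓡∂ 3)).map_target ht
      show (𝓡∂ 3).IsBoundaryPoint _
      rw [isBoundaryPoint_iff_of_mem_maximalAtlas (I := 𝓡∂ 3) (m := ∞) (by simp)
        hm.domChart_mem_maximalAtlas hsrc, (hm.domChart.extend (𝓡∂ 3)).right_inv ht, hfront]
      exact hq0 x
    exact hF.comp_contMDiffOn (hτ.comp ((contMDiffOn_extend_symm hm.domChart_mem_maximalAtlas).comp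
      (hqs.mono fun x hx => hx.2.1) hmaps₁) hmaps₂)
  · rintro z' ⟨hz'U, -, -⟩
    have hz's : σ z' ∈ hm.domChart.source := by rw [← hU₁eq]; exact hz'U
    have hws : σ z' ∈ (hm.domChart.extend (𝓡∂ 3)).source := by rwa [OpenPartialHomeomorph.extend_source]
    show F (τ ((hm.domChart.extend (𝓡∂ 3)).symm (q (h₁ (σ z'))))) = F z'
    rw [(key (σ z') hz's (hσ z')).1, (hm.domChart.extend (𝓡∂ 3)).left_inv hws, hτσ]

end LocalExtension

section Gluing

variable {X : Type*} [TopologicalSpace X] [T2Space X] [CompactSpace X]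
  [ChartedSpace (EuclideanSpace ℝ (Fin 4)) X] [IsManifold (𝓡 4) ∞ X]
  {Y : Type*} [TopologicalSpace Y] [T2Space Y] [CompactSpace Y] [Nonempty Y]
  [ChartedSpace (EuclideanSpace ℝ (Fin 4)) Y] [IsManifold (𝓡 4) ∞ Y]

/-- **Gluing local ambient extensions**: embed `Y ↪ ℝᴺ` (Whitney) with a smooth normal retraction
of a tube (`exists_normalRetraction`), average the local extensions with a smooth partition of
unity, retract.  (Copy of `Literature.Topology.FourManifolds.exists_ambient_extension_of_local`,
p93382.) [cite: HirschDT1976, Ch. 4 §5 Thm. 5.1–5.2] -/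
private theorem exists_ambient_extension_of_local' {K : Set X} (hK : IsClosed K) (f : ↥K → Y)
    (hloc : ∀ x ∈ K, ∃ V : Set X, IsOpen V ∧ x ∈ V ∧ ∃ Ψ : X → Y,
      ContMDiffOn (𝓡 4) (𝓡 4) ∞ Ψ V ∧ ∀ (y : X) (hy : y ∈ K), y ∈ V → Ψ y = f ⟨y, hy⟩) :
    ∃ (U : Set X) (Ψ : X → Y), IsOpen U ∧ K ⊆ U ∧ ContMDiffOn (𝓡 4) (𝓡 4) ∞ Ψ U ∧
      ∀ y : ↥K, Ψ y = f y := by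
  classical
  obtain ⟨N, j, hj, hjemb, hjinj⟩ := exists_embedding_euclidean_of_compact (I := 𝓡 4) (M := Y)
  obtain ⟨ε, hε, hW, hr, hret⟩ := exists_normalRetraction (I := 𝓡 4) hj hjemb.injective hjinj
  have hrj : ∀ y, j y ∈ normalTube (𝓡 4) j ε ∧ normalRetraction (𝓡 4) j ε (j y) = y := fun y => by
    simpa using hret y 0 (Submodule.zero_mem _) (by simpa using hε)
  let t : X → Set (EuclideanSpace ℝ (Fin N)) := fun x => if hx : x ∈ K then {j (f ⟨x, hx⟩)} else univ
  have ht : ∀ x, Convex ℝ (t x) := fun x => by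
    by_cases hx : x ∈ K
    · simp only [t, dif_pos hx]; exact convex_singleton _
    · simp only [t, dif_neg hx]; exact convex_univ
  have hloc' : ∀ x : X, ∃ U ∈ 𝓝 x, ∃ g : X → EuclideanSpace ℝ (Fin N),
      ContMDiffOn (𝓡 4) 𝓘(ℝ, EuclideanSpace ℝ (Fin N)) ∞ g U ∧ ∀ y ∈ U, g y ∈ t y := by
    intro x
    by_cases hx : x ∈ K
    · obtain ⟨V, hV, hxV, Ψ, hΨ, hΨf⟩ := hloc x hx
      refine ⟨V, hV.mem_nhds hxV, j ∘ Ψ, hj.comp_contMDiffOn hΨ, fun y hy => ?_⟩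
      by_cases hyK : y ∈ K
      · simp only [t, dif_pos hyK, comp_apply, hΨf y hyK hy, mem_singleton_iff]
      · simp only [t, dif_neg hyK, mem_univ]
    · refine ⟨Kᶜ, hK.isOpen_compl.mem_nhds hx, fun _ => 0, contMDiffOn_const, fun y hy => ?_⟩
      simp only [t, dif_neg (show y ∉ K from hy), mem_univ]
  obtain ⟨G, hG⟩ := exists_contMDiffMap_forall_mem_convex_of_local (𝓡 4) ht hloc' (n := ⊤)
  have hGK : ∀ y : ↥K, G y = j (f y) := fun y => by
    simpa only [t, dif_pos y.2, mem_singleton_iff] using hG y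
  refine ⟨G ⁻¹' normalTube (𝓡 4) j ε, normalRetraction (𝓡 4) j ε ∘ G, hW.preimage G.2.continuous,
    fun y hy => ?_, hr.comp G.2.contMDiffOn fun x hx => hx, fun y => ?_⟩
  · show G y ∈ normalTube (𝓡 4) j ε; rw [hGK ⟨y, hy⟩]; exact (hrj _).1
  · show normalRetraction (𝓡 4) j ε (G y) = f y; rw [hGK y]; exact (hrj _).2

end Gluing

/-- `∂H ≃ₜ F` along a clause-(iii) embedding, equal to `f` on points. [cite: GayKirby2016, Def. 1] -/
private theorem exists_homeomorph_boundary_centralSurface' {X : Type*} [TopologicalSpace X]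
    {S : Fin 3 → Set X} {M : Type*} [TopologicalSpace M] [ChartedSpace (EuclideanHalfSpace 3) M]
    {f : M → X} (hf : Topology.IsEmbedding f) (hbd : f '' (𝓡∂ 3).boundary M = ⋂ l, S l) :
    ∃ e : ↥((𝓡∂ 3).boundary M) ≃ₜ centralSurface S, ∀ w, ((e w : centralSurface S) : X) = f w :=
  ⟨(hf.comp Topology.IsEmbedding.subtypeVal).toHomeomorph.trans
    (Homeomorph.setCongr (by rw [range_comp, Subtype.range_coe, hbd])), fun _ => rfl⟩

/-- `π₁` of a triple composite of based homeomorphisms. [cite: HatcherAT2002, Prop. 1.18 (p. 37)] -/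
private theorem mapOfEq_trans_trans_apply' {A B C D : Type*} [TopologicalSpace A] [TopologicalSpace B]
    [TopologicalSpace C] [TopologicalSpace D] (e₁ : A ≃ₜ B) (e₂ : B ≃ₜ C) (e₃ : C ≃ₜ D) {a : A}
    {b : B} {c : C} {d : D} (h₁ : e₁ a = b) (h₂ : e₂ b = c) (h₃ : e₃ c = d)
    (h : (e₁.trans e₂).trans e₃ a = d) (γ : FundamentalGroup A a) :
    FundamentalGroup.mapOfEq (⟨(e₁.trans e₂).trans e₃, ((e₁.trans e₂).trans e₃).continuous⟩ : C(A, D)) h γ =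
      FundamentalGroup.mapOfEq (e₃ : C(C, D)) h₃
        (FundamentalGroup.mapOfEq (e₂ : C(B, C)) h₂ (FundamentalGroup.mapOfEq (e₁ : C(A, B)) h₁ γ)) := by
  rw [← FundamentalGroup.mapOfEq_comp_apply, ← FundamentalGroup.mapOfEq_comp_apply]
  rfl

/-! ## The reduction and the registered stub -/

/-- **`DehnNielsenBaerSurfaceSmooth → DehnNielsenBaerCentral`**: clause-(iii) handlebody embeddings
`f`, `f'` (`IsGKTrisection.exists_isHandlebody`), `Θ : H ≅ H'` (UNIQ), the fact on `∂H'`,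
`ψ = f' ∘ φ ∘ Θ ∘ f⁻¹`; `ψ_* = θ` by functoriality; ambient smoothness of `ψ`, `ψ⁻¹` by the two lemmas
above. [cite: ZieschangVogtColdewey1980, Thm. 5.6.2] [cite: FarbMargalit2012, Thm. 8.1 and Thm. 4.6] -/
theorem dehnNielsenBaerCentral_of_surfaceSmooth (hDNB : Literature.Topology.FourManifolds.DehnNielsenBaerSurfaceSmooth) :
    DehnNielsenBaerCentral := by
  intro X _ _ _ _ _ _ _ o X' _ _ _ _ _ _ _ o' g k S S' hS hS' x₀ x₀' μ θ
  classical
  obtain ⟨H, _, _, hMH, f, hH, hf, -, hbd⟩ :=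
    hS.isGKTrisection.exists_isHandlebody ⟨o⟩ (show (0 : Fin 3) ≠ 1 by decide)
  obtain ⟨H', _, _, hMH', f', hH', hf', -, hbd'⟩ :=
    hS'.isGKTrisection.exists_isHandlebody ⟨o'⟩ (show (0 : Fin 3) ≠ 1 by decide)
  haveI := hMH; haveI := hMH'
  haveI : T2Space H := hf.isEmbedding.t2Space; haveI : T2Space H' := hf'.isEmbedding.t2Space
  haveI : SecondCountableTopology H := hf.isEmbedding.secondCountableTopology
  haveI : SecondCountableTopology H' := hf'.isEmbedding.secondCountableTopology
  haveI : Nonempty X := ⟨(x₀ : X)⟩; haveI : Nonempty X' := ⟨(x₀' : X')⟩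
  -- `Θ : H ≅ H'` (uniqueness of genus-`g` handlebodies, proved in the tree)
  obtain ⟨Θ⟩ := IsHandlebody.nonempty_diffeomorph_of_oneHandle oneHandle_nonempty_diffeomorph_holds
    g H H' hH hH'
  have hn : (∞ : WithTop ℕ∞) ≠ 0 := by simp
  have hΘb : ∀ w ∈ (𝓡∂ 3).boundary H, Θ w ∈ (𝓡∂ 3).boundary H' := fun w hw =>
    (Θ.image_boundary hn) ▸ mem_image_of_mem _ hw
  have hΘb' : ∀ v ∈ (𝓡∂ 3).boundary H', Θ.symm v ∈ (𝓡∂ 3).boundary H := fun v hv =>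
    (Θ.symm.image_boundary hn) ▸ mem_image_of_mem _ hv
  -- identifications of the two central surfaces with `∂H'`
  obtain ⟨eH, heH⟩ := exists_homeomorph_boundary_centralSurface' (S := S) hf.isEmbedding hbd
  obtain ⟨eH', heH'⟩ := exists_homeomorph_boundary_centralSurface' (S := S') hf'.isEmbedding hbd'
  let dΘ : ↥((𝓡∂ 3).boundary H) ≃ₜ ↥((𝓡∂ 3).boundary H') := Θ.boundaryHomeomorph hn
  let e : centralSurface S ≃ₜ ↥((𝓡∂ 3).boundary H') := eH.symm.trans dΘ
  let e' : centralSurface S' ≃ₜ ↥((𝓡∂ 3).boundary H') := eH'.symm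
  have hdΘ : ∀ w : ↥((𝓡∂ 3).boundary H), ((dΘ w : ↥((𝓡∂ 3).boundary H')) : H') = Θ w := fun w => rfl
  have hdΘ' : ∀ u : ↥((𝓡∂ 3).boundary H'), ((dΘ.symm u : ↥((𝓡∂ 3).boundary H)) : H) = Θ.symm u :=
    fun u => by
      have h := hdΘ (dΘ.symm u)
      rw [dΘ.apply_symm_apply] at h; rw [h, Diffeomorph.symm_apply_apply]
  have heHsymm : ∀ (w : H) (hw : w ∈ (𝓡∂ 3).boundary H) (hx : f w ∈ ⋂ l, S l),
      eH.symm ⟨f w, hx⟩ = ⟨w, hw⟩ := fun w hw hx => by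
    rw [Homeomorph.symm_apply_eq]; exact Subtype.ext (heH ⟨w, hw⟩).symm
  have heH'symm : ∀ (v : H') (hv : v ∈ (𝓡∂ 3).boundary H') (hy : f' v ∈ ⋂ l, S' l),
      eH'.symm ⟨f' v, hy⟩ = ⟨v, hv⟩ := fun v hv hy => by
    rw [Homeomorph.symm_apply_eq]; exact Subtype.ext (heH' ⟨v, hv⟩).symm
  -- Dehn–Nielsen–Baer on the boundary surface `∂H'` of the handlebody `H'`
  obtain ⟨φ, hφ, hreal⟩ := hDNB g H' hH' (BoundaryManifold.boundaryData 2 H') (e x₀) (e' x₀')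
    (μ.trans (Homeomorph.fundamentalGroupCongr e rfl))
    ((μ.trans θ).trans (Homeomorph.fundamentalGroupCongr e' rfl))
  let φH : ↥((𝓡∂ 3).boundary H') ≃ₜ ↥((𝓡∂ 3).boundary H') := φ.toHomeomorph
  have hφH : ∀ v, φH v = φ v := fun v => rfl
  have hφc : ContMDiff (𝓡 2) (𝓡 2) ∞ (fun v : ↥((𝓡∂ 3).boundary H') => φH v) := φ.contMDiff
  have hφc' : ContMDiff (𝓡 2) (𝓡 2) ∞ (fun v : ↥((𝓡∂ 3).boundary H') => φH.symm v) :=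
    φ.symm.contMDiff
  -- the based homeomorphism `ψ = e'⁻¹ ∘ φ ∘ e`
  let ψ : centralSurface S ≃ₜ centralSurface S' := (e.trans φH).trans e'.symm
  have hψ : ψ x₀ = x₀' := by
    show e'.symm (φH (e x₀)) = x₀'; rw [hφH, hφ]; exact e'.symm_apply_apply x₀'
  have hψval : ∀ (w : H) (hw : w ∈ (𝓡∂ 3).boundary H) (hx : f w ∈ ⋂ l, S l),
      ((ψ ⟨f w, hx⟩ : centralSurface S') : X') = f' (φH ⟨Θ w, hΘb w hw⟩) := by
    intro w hw hx
    have h2 : dΘ ⟨w, hw⟩ = ⟨Θ w, hΘb w hw⟩ := Subtype.ext (hdΘ _)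
    show ((eH' (φH (dΘ (eH.symm ⟨f w, hx⟩))) : centralSurface S') : X') = _
    rw [heHsymm w hw hx, h2, heH']
  have hψsymm : ∀ (v : H') (hv : v ∈ (𝓡∂ 3).boundary H') (hy : f' v ∈ ⋂ l, S' l),
      ((ψ.symm ⟨f' v, hy⟩ : centralSurface S) : X) = f (Θ.symm (φH.symm ⟨v, hv⟩)) := by
    intro v hv hy
    show ((eH (dΘ.symm (φH.symm (eH'.symm ⟨f' v, hy⟩))) : centralSurface S) : X) = _
    rw [heH'symm v hv hy, heH, hdΘ']
  -- a smooth left inverse of `∂H' ↪ H'`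
  haveI : Nonempty ↥((𝓡∂ 3).boundary H') := ⟨e' x₀'⟩
  let ginv : H' → ↥((𝓡∂ 3).boundary H') := Function.invFun Subtype.val
  have hginv : ∀ v : ↥((𝓡∂ 3).boundary H'), ginv v.1 = v :=
    Function.leftInverse_invFun Subtype.val_injective
  have hSE := BoundaryManifold.isSmoothEmbedding_subtype_val (n := 2) (W := H')
  have hginvs : ContMDiffOn (𝓡∂ 3) (𝓡 2) ∞ ginv ((𝓡∂ 3).boundary H') := by
    have h := contMDiffOn_leftInverse_of_isImmersion hSE.isImmersion hSE.isEmbedding hginv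
    rwa [Subtype.range_coe] at h
  have hval : ContMDiff (𝓡 2) (𝓡∂ 3) ∞ (Subtype.val : ↥((𝓡∂ 3).boundary H') → H') := hSE.contMDiff
  refine ⟨ψ, hψ, ?_, ?_, ?_⟩
  · -- ambient smoothness of `ψ = f' ∘ φ ∘ Θ ∘ f⁻¹`
    refine exists_ambient_extension_of_local' hS.isGKTrisection.isCompact_iInter.isClosed
      (fun x => ((ψ x : centralSurface S') : X')) fun x hx => ?_
    have hx' := hx; rw [← hbd] at hx'; obtain ⟨w, hw, rfl⟩ := hx'
    obtain ⟨V, hV, hwV, Ψ, hΨ, hΨv⟩ := exists_local_ambient_extension'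
      (T := ↥((𝓡∂ 3).boundary H')) hf (σ := fun v => Θ.symm v.1) (τ := ginv ∘ Θ)
      (fun v => by simp only [comp_apply, Diffeomorph.apply_symm_apply]; exact hginv v)
      (fun v => hΘb' v.1 v.2) (hginvs.comp Θ.contMDiff.contMDiffOn fun w hw => hΘb w hw)
      (F := fun v => f' (φH v)) (hf'.contMDiff.comp (hval.comp hφc)) ⟨Θ w, hΘb w hw⟩
    refine ⟨V, hV, by simpa using hwV, Ψ, hΨ, fun y hy hyV => ?_⟩
    have hy' := hy; rw [← hbd] at hy'; obtain ⟨w', hw', rfl⟩ := hy'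
    have h := hΨv ⟨Θ w', hΘb w' hw'⟩ (by simpa using hyV)
    simp only [Diffeomorph.symm_apply_apply] at h
    rw [h, hψval w' hw' hy]
  · -- ambient smoothness of `ψ⁻¹ = f ∘ Θ⁻¹ ∘ φ⁻¹ ∘ f'⁻¹`
    refine exists_ambient_extension_of_local' hS'.isGKTrisection.isCompact_iInter.isClosed
      (fun y => ((ψ.symm y : centralSurface S) : X)) fun y hy => ?_
    have hy' := hy; rw [← hbd'] at hy'; obtain ⟨v, hv, rfl⟩ := hy'
    obtain ⟨V, hV, hvV, Ψ, hΨ, hΨv⟩ := exists_local_ambient_extension'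
      (T := ↥((𝓡∂ 3).boundary H')) hf' (σ := Subtype.val) (τ := ginv) hginv (fun v => v.2) hginvs
      (F := fun u => f (Θ.symm (φH.symm u)))
      (hf.contMDiff.comp (Θ.symm.contMDiff.comp (hval.comp hφc'))) ⟨v, hv⟩
    refine ⟨V, hV, hvV, Ψ, hΨ, fun y hy hyV => ?_⟩
    have hy' := hy; rw [← hbd'] at hy'; obtain ⟨v', hv', rfl⟩ := hy'
    rw [hΨv ⟨v', hv'⟩ hyV, hψsymm v' hv' hy]
  · -- `ψ_* = θ`
    intro γ
    obtain ⟨γ₀, rfl⟩ := μ.surjective γ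
    have hreal' : FundamentalGroup.mapOfEq
        (φH : C(↥((𝓡∂ 3).boundary H'), ↥((𝓡∂ 3).boundary H'))) hφ
        (FundamentalGroup.mapOfEq (e : C(centralSurface S, ↥((𝓡∂ 3).boundary H'))) rfl (μ γ₀)) =
          FundamentalGroup.mapOfEq (e' : C(centralSurface S', ↥((𝓡∂ 3).boundary H'))) rfl
            (θ (μ γ₀)) :=
      hreal γ₀
    rw [mapOfEq_trans_trans_apply' e φH e'.symm rfl hφ (e'.symm_apply_apply x₀') hψ (μ γ₀), hreal',
      ← Homeomorph.fundamentalGroupCongr_symm_apply e' rfl,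
      ← Homeomorph.fundamentalGroupCongr_apply e' rfl, MulEquiv.symm_apply_apply]

/-- **stub 5b — Dehn–Nielsen–Baer on central surfaces from the surface fact** (registered stub of
line `lp-by-sphere-system-surgery`, verbatim; hypothesis = the delegated fact `stub_dnbSurface`). -/
theorem stub_dehnNielsenBaer : Literature.Topology.FourManifolds.DehnNielsenBaerSurfaceSmooth → DehnNielsenBaerCentral :=
  dehnNielsenBaerCentral_of_surfaceSmooth

end Summit.SmoothPoincare4.SmoothPoincare4.Cruxes.AgkCor6Sufficiency.LpBySphereSystemSurgery

end
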